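import Literature.NumberTheory.Sieve.GoldbachLinnikRomanovCertDefs
import Literature.NumberTheory.Sieve.GoldbachLinnikRomanovCertData1
import Literature.NumberTheory.Sieve.GoldbachLinnikRomanovCertData2

/-!
# Romanov certificate — head sums 6/7

Kernel evaluation (`decide +kernel`) of the checker of `GoldbachLinnikRomanovCertDefs.lean` on the records
`parseRecs 20000 (digitsOf (fsegs1 ++ fsegs2))` of `GoldbachLinnikRomanovCertData1/2.lean`; soundness: `GoldbachLinnikRomanovCertSound1.lean`,
`GoldbachLinnikRomanovCertTop.lean`. [folklore]
-/

namespace Literature.NumberTheory.Sieve.RomanovCert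

set_option maxHeartbeats 0 in
/-- The head accumulators `(T⁺, T⁻, I, S⁺, S⁻, ok)` on `d ∈ [16384, 20480)`. [folklore] -/
theorem head_16384 : headSums (parseRecs 20000 (digitsOf (fsegs1 ++ fsegs2))) 16384 4096 = (498171157651731588, 0, 126306654766976, 9144065906052032094084, 0, true) := by
  decide +kernel

set_option maxHeartbeats 0 in
/-- The head accumulators `(T⁺, T⁻, I, S⁺, S⁻, ok)` on `d ∈ [20480, 24576)`. [folklore] -/
theorem head_20480 : headSums (parseRecs 20000 (digitsOf (fsegs1 ++ fsegs2))) 20480 4096 = (407111157686502484, 0, 115888842824400, 9145681319288939070604, 0, true) := by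
  decide +kernel

end Literature.NumberTheory.Sieve.RomanovCert
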